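import Summits.MatrixMultiplication.OmegaCensus.TriangleTorusImbalance
import Summits.MatrixMultiplication.OmegaCensus.ThreeSetTriangleFactor
import Summits.MatrixMultiplication.OmegaCensus.CubeSymmetricForm
import Mathlib.Tactic.IntervalCases

/-!
# No part of size three in a cube symmetric form over `ℤ_p × ℤ_p`, for every prime `p` (kernel)

ω-census `pub-omega`, family (b3), seat pub-omega-group gen 33.  Framing: lottery ticket; floor = certified bounds/negative
ranges.  VALUE: a KERNEL all-`p` theorem of the group-theoretic (Cohn–Umans) census of three-set cube law triples — the
"Conjecture T / Corollary C" of RESULTS-g31/g32 (HOME/pub-omega-group-g32/), previously at paper grade; NOT progress on ω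
and no census word changes (every cell `(3, d, e)@p²` in range was already NONE; this certifies the whole `|W| = 3` column of
`Dih(ℤ_p²)` for all primes at once).

* `triangleFactorTwo` — sanity: the hypothesis structure `TriangleFactor` is inhabited (`n = 2`).
* `card_sub_card_bound` — the Finset form of Theorem B (`TriangleTorusImbalance`): if the up-triangles `t + {0,e₁,e₂}`
  (`t ∈ T`) and down-triangles `m − {0,e₁,e₂}` (`m ∈ M`) partition `ℤ_p² ∖ {z₀}` and `3 ∤ p`, then `3·|#T − #M| ≤ 4p + 2`
  (the bridge `triangleFactorOfFinsets` builds the `TriangleFactor p` of `TriangleTorusLadder` and identifies the counts).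
* **`cube_form_card_ne_three`** — a cube symmetric form `(W, X, Y, x₀)` over `ℤ_p × ℤ_p` (`p` prime) has `|W| ≠ 3`;
  `cube_form_no_part_three`: also `|X| ≠ 3`, `|Y| ≠ 3`.  Proof: `triangle_factor_of_part_three` (g32) gives a partition with
  `#T = 2#M`, `9#M + 1 = p²`; the bound forces `p ≤ 12`, and `p² ≡ 1 (mod 9)` has no prime solution `p ≤ 12`.
* **`cube_law_no_coset_part_three`** — hence no TPP triple with cube coset parts in a dihedral-like group over `ℤ_p × ℤ_p`
  (`p` an odd prime, any presentation constant `c₀`) attaining `3|S||T||U| + 8 = 8p²` has a coset part of size `3`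
  (via `cube_symmetric_form_of_law`, g7).
-/

namespace Summit.MatrixMultiplication.OmegaCensus

open Finset TriangleTorus

section Bridge

variable {p : ℕ} [Fact p.Prime]

/-- Counting the members of a three-element set inside a Finset. [folklore] -/
theorem card_filter_three {α : Type*} [DecidableEq α] (S : Finset α) (x y z : α) (hxy : x ≠ y) (hxz : x ≠ z)
    (hyz : y ≠ z) (P : α → Prop) [DecidablePred P] (hP : ∀ s, P s ↔ s = x ∨ s = y ∨ s = z) :
    ((S.filter P).card : ℤ) = (if x ∈ S then 1 else 0) + (if y ∈ S then 1 else 0) + (if z ∈ S then 1 else 0) := by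
  have e : S.filter P = ({x, y, z} : Finset α).filter (· ∈ S) := by
    ext s; simp only [mem_filter, mem_insert, mem_singleton, hP]; tauto
  rw [e, Finset.card_filter, Nat.cast_sum, sum_insert (by simp [hxy, hxz]), sum_insert (by simp [hyz]), sum_singleton]
  push_cast
  ring

/-- `(decide P).toNat` as an indicator. [folklore] -/
theorem toNat_decide_cast (P : Prop) [Decidable P] : (((decide P).toNat : ℕ) : ℤ) = if P then 1 else 0 := by
  by_cases hP : P <;> simp [hP]

/-- **The triangle factor of a Finset partition.**  Up-triangles `t + {0,e₁,e₂}` (`t ∈ T`) and down-triangles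
`m − {0,e₁,e₂}` (`m ∈ M`) partitioning `ℤ_p² ∖ {z₀}` (in the counting form produced by `triangle_factor_of_part_three`) give
a `TriangleFactor p` after translating the hole to the origin and lifting to `ℤ²`. [folklore] -/
def triangleFactorOfFinsets (T M : Finset (ZMod p × ZMod p)) (z₀ : ZMod p × ZMod p)
    (h : ∀ a, (M.filter fun m => m - a ∈ ({0, (1, 0), (0, 1)} : Finset (ZMod p × ZMod p))).card +
      (T.filter fun t => a - t ∈ ({0, (1, 0), (0, 1)} : Finset (ZMod p × ZMod p))).card = if a = z₀ then 0 else 1) :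
    TriangleFactor p where
  up c j := decide ((((c : ZMod p) + z₀.1, (j : ZMod p) + z₀.2) : ZMod p × ZMod p) ∈ T)
  dn c j := decide ((((c : ZMod p) + z₀.1, (j : ZMod p) + z₀.2) : ZMod p × ZMod p) ∈ M)
  up_add_left c j := by simp
  up_add_right c j := by simp
  dn_add_left c j := by simp
  dn_add_right c j := by simp
  cover c j := by
    have e1 : ((1, 0) : ZMod p × ZMod p) ≠ 0 := by simp [Prod.ext_iff]
    have e2 : ((0, 1) : ZMod p × ZMod p) ≠ 0 := by simp [Prod.ext_iff]
    have e12 : ((1, 0) : ZMod p × ZMod p) ≠ (0, 1) := by simp [Prod.ext_iff]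
    set a : ZMod p × ZMod p := ((c : ZMod p) + z₀.1, (j : ZMod p) + z₀.2) with ha
    -- the down-triangles through `a`
    have hM : ((M.filter fun m => m - a ∈ ({0, (1, 0), (0, 1)} : Finset (ZMod p × ZMod p))).card : ℤ) =
        (if a ∈ M then 1 else 0) + (if a + (1, 0) ∈ M then 1 else 0) + (if a + (0, 1) ∈ M then 1 else 0) := by
      refine card_filter_three M a (a + (1, 0)) (a + (0, 1)) (fun h' => e1 (left_eq_add.1 h'))
        (fun h' => e2 (left_eq_add.1 h')) (fun h' => e12 (add_left_cancel h')) _ fun s => ?_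
      simp only [mem_insert, mem_singleton]
      constructor
      · rintro (h' | h' | h')
        · exact Or.inl (sub_eq_zero.1 h')
        · exact Or.inr (Or.inl (by rw [← h']; abel))
        · exact Or.inr (Or.inr (by rw [← h']; abel))
      · rintro (rfl | rfl | rfl)
        · exact Or.inl (sub_self a)
        · exact Or.inr (Or.inl (by abel))
        · exact Or.inr (Or.inr (by abel))
    -- the up-triangles through `a`
    have hT : ((T.filter fun t => a - t ∈ ({0, (1, 0), (0, 1)} : Finset (ZMod p × ZMod p))).card : ℤ) =
        (if a ∈ T then 1 else 0) + (if a - (1, 0) ∈ T then 1 else 0) + (if a - (0, 1) ∈ T then 1 else 0) := by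
      refine card_filter_three T a (a - (1, 0)) (a - (0, 1)) (fun h' => e1 (sub_eq_self.1 h'.symm))
        (fun h' => e2 (sub_eq_self.1 h'.symm)) (fun h' => e12 (sub_right_injective h')) _ fun s => ?_
      simp only [mem_insert, mem_singleton]
      constructor
      · rintro (h' | h' | h')
        · exact Or.inl (sub_eq_zero.1 h').symm
        · exact Or.inr (Or.inl (by rw [← h']; abel))
        · exact Or.inr (Or.inr (by rw [← h']; abel))
      · rintro (rfl | rfl | rfl)
        · exact Or.inl (sub_self a)
        · exact Or.inr (Or.inl (by abel))
        · exact Or.inr (Or.inr (by abel))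
    have hc' : (if a ∈ M then 1 else 0) + (if a + (1, 0) ∈ M then 1 else 0) + (if a + (0, 1) ∈ M then 1 else 0) +
        ((if a ∈ T then 1 else 0) + (if a - (1, 0) ∈ T then 1 else 0) + (if a - (0, 1) ∈ T then 1 else 0)) =
        (((if a = z₀ then 0 else 1 : ℕ)) : ℤ) := by
      rw [← hM, ← hT]; exact_mod_cast h a
    -- identify the six shifted points and the hole condition
    have p1 : ((((c + 1 : ℤ) : ZMod p) + z₀.1, ((j : ℤ) : ZMod p) + z₀.2) : ZMod p × ZMod p) = a + (1, 0) := by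
      ext <;> simp only [ha, Prod.fst_add, Prod.snd_add, Int.cast_add, Int.cast_one] <;> ring
    have p2 : ((((c : ℤ) : ZMod p) + z₀.1, ((j + 1 : ℤ) : ZMod p) + z₀.2) : ZMod p × ZMod p) = a + (0, 1) := by
      ext <;> simp only [ha, Prod.fst_add, Prod.snd_add, Int.cast_add, Int.cast_one] <;> ring
    have p3 : ((((c - 1 : ℤ) : ZMod p) + z₀.1, ((j : ℤ) : ZMod p) + z₀.2) : ZMod p × ZMod p) = a - (1, 0) := by
      ext <;> simp only [ha, Prod.fst_sub, Prod.snd_sub, Int.cast_sub, Int.cast_one] <;> ring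
    have p4 : ((((c : ℤ) : ZMod p) + z₀.1, ((j - 1 : ℤ) : ZMod p) + z₀.2) : ZMod p × ZMod p) = a - (0, 1) := by
      ext <;> simp only [ha, Prod.fst_sub, Prod.snd_sub, Int.cast_sub, Int.cast_one] <;> ring
    have hz : ((p : ℤ) ∣ c ∧ (p : ℤ) ∣ j) ↔ a = z₀ := by
      rw [ha, Prod.ext_iff, ← ZMod.intCast_zmod_eq_zero_iff_dvd, ← ZMod.intCast_zmod_eq_zero_iff_dvd]
      simp only [add_eq_right]
    simp only [p1, p2, p3, p4, hz]
    zify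
    simp only [toNat_decide_cast]
    push_cast at hc'
    linarith

/-- Summing a function of `ZMod p` over the representatives `0, …, p−1`. [folklore] -/
theorem sum_range_natCast (f : ZMod p → ℤ) : ∑ c ∈ range p, f (c : ZMod p) = ∑ a : ZMod p, f a := by
  have hinj : Set.InjOn (fun c : ℕ => (c : ZMod p)) ↑(range p) := by
    intro c hc d hd hcd
    have := (ZMod.natCast_eq_natCast_iff' c d p).1 hcd
    rw [coe_range, Set.mem_Iio] at hc hd
    rwa [Nat.mod_eq_of_lt hc, Nat.mod_eq_of_lt hd] at this
  have himg : (range p).image (fun c : ℕ => (c : ZMod p)) = univ := by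
    ext a
    simp only [mem_image, mem_range, mem_univ, iff_true]
    exact ⟨a.val, ZMod.val_lt a, ZMod.natCast_zmod_val a⟩
  rw [← himg, sum_image hinj]

/-- The double indicator sum over the fundamental domain `[0,p)²` (shifted by `(u, v)`) counts the Finset. [folklore] -/
theorem sum_sum_indicator_eq_card (S : Finset (ZMod p × ZMod p)) (u v : ZMod p) :
    (∑ c ∈ range p, ∑ j ∈ range p,
      if ((((c : ℤ) : ZMod p) + u, ((j : ℤ) : ZMod p) + v) : ZMod p × ZMod p) ∈ S then (1 : ℤ) else 0) = S.card := by
  simp only [Int.cast_natCast]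
  have inner : ∀ a : ZMod p, (∑ j ∈ range p, if ((a + u, (j : ZMod p) + v) : ZMod p × ZMod p) ∈ S then (1 : ℤ) else 0)
      = ∑ b : ZMod p, if ((a + u, b) : ZMod p × ZMod p) ∈ S then (1 : ℤ) else 0 := by
    intro a
    rw [sum_range_natCast (fun b => if ((a + u, b + v) : ZMod p × ZMod p) ∈ S then (1 : ℤ) else 0)]
    exact Equiv.sum_comp (Equiv.addRight v) (fun b => if ((a + u, b) : ZMod p × ZMod p) ∈ S then (1 : ℤ) else 0)
  have outer : (∑ c ∈ range p, ∑ b : ZMod p, if (((c : ZMod p) + u, b) : ZMod p × ZMod p) ∈ S then (1 : ℤ) else 0)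
      = ∑ a : ZMod p, ∑ b : ZMod p, if ((a, b) : ZMod p × ZMod p) ∈ S then (1 : ℤ) else 0 := by
    rw [sum_range_natCast (fun a => ∑ b : ZMod p, if ((a + u, b) : ZMod p × ZMod p) ∈ S then (1 : ℤ) else 0)]
    exact Equiv.sum_comp (Equiv.addRight u) (fun a => ∑ b : ZMod p, if ((a, b) : ZMod p × ZMod p) ∈ S then (1 : ℤ) else 0)
  simp only [inner]
  rw [outer, ← Fintype.sum_prod_type', Finset.sum_boole, Finset.filter_univ_mem]

/-- Tile counts of the bridge: up-tiles. [folklore] -/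
theorem upCount_eq (T M : Finset (ZMod p × ZMod p)) (z₀ : ZMod p × ZMod p) (h) :
    (triangleFactorOfFinsets T M z₀ h).upCount = T.card := by
  unfold TriangleFactor.upCount
  simp only [triangleFactorOfFinsets, decide_eq_true_eq]
  exact sum_sum_indicator_eq_card T z₀.1 z₀.2

/-- Tile counts of the bridge: down-tiles. [folklore] -/
theorem dnCount_eq (T M : Finset (ZMod p × ZMod p)) (z₀ : ZMod p × ZMod p) (h) :
    (triangleFactorOfFinsets T M z₀ h).dnCount = M.card := by
  unfold TriangleFactor.dnCount
  simp only [triangleFactorOfFinsets, decide_eq_true_eq]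
  exact sum_sum_indicator_eq_card M z₀.1 z₀.2

/-- **Theorem B in Finset form.**  If up-triangles `t + {0, e₁, e₂}` (`t ∈ T`) and down-triangles `m − {0, e₁, e₂}`
(`m ∈ M`) partition `ℤ_p² ∖ {z₀}` and `3 ∤ p`, then `3·|#T − #M| ≤ 4p + 2`. [folklore] -/
theorem card_sub_card_bound (hp3 : ¬ 3 ∣ p) (T M : Finset (ZMod p × ZMod p)) (z₀ : ZMod p × ZMod p)
    (h : ∀ a, (M.filter fun m => m - a ∈ ({0, (1, 0), (0, 1)} : Finset (ZMod p × ZMod p))).card +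
      (T.filter fun t => a - t ∈ ({0, (1, 0), (0, 1)} : Finset (ZMod p × ZMod p))).card = if a = z₀ then 0 else 1) :
    3 * |(T.card : ℤ) - M.card| ≤ 4 * p + 2 := by
  have := (triangleFactorOfFinsets T M z₀ h).three_mul_abs_sub_le hp3 (Fact.out : p.Prime).one_lt.le
  rwa [upCount_eq, dnCount_eq] at this

end Bridge

section Sanity

/-- Sanity check (non-vacuity of the hypothesis structure): the single up-triangle `{(1,1), (0,1), (1,0)}` is a triangle
factor of `ℤ_2² ∖ {0}` (for it, `three_mul_abs_sub_le` reads `3·|1 − 0| ≤ 10`). [folklore] -/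
def triangleFactorTwo : TriangleFactor 2 where
  up c j := decide (c % 2 = 1 ∧ j % 2 = 1)
  dn _ _ := false
  up_add_left c j := by simp
  up_add_right c j := by simp
  dn_add_left _ _ := rfl
  dn_add_right _ _ := rfl
  cover c j := by
    have tb : ∀ (P : Prop) [Decidable P], (decide P).toNat = if P then 1 else 0 := by
      intro P _; by_cases hP : P <;> simp [hP]
    simp only [tb, Bool.toNat_false, add_zero, Nat.cast_ofNat]
    rcases Int.emod_two_eq_zero_or_one c with hc | hc <;> rcases Int.emod_two_eq_zero_or_one j with hj | hj <;>
      simp [hc, hj, Int.sub_emod, Int.dvd_iff_emod_eq_zero]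

end Sanity

section Corollary

variable {p : ℕ} [Fact p.Prime]

/-- **No part of size three (Corollary C of RESULTS-g32, kernel).**  A cube symmetric form `(W, X, Y, x₀)` over
`ℤ_p × ℤ_p` — the three signed sums `−W+X+Y`, `W−X+Y`, `W+X−Y` injective on the box, pairwise disjoint and covering
`ℤ_p² ∖ {x₀}` — never has `|W| = 3`, for any prime `p`. [folklore] -/
theorem cube_form_card_ne_three {W X Y : Finset (ZMod p × ZMod p)} {x₀ : ZMod p × ZMod p}
    (h₁ : Set.InjOn (fun q : (ZMod p × ZMod p) × (ZMod p × ZMod p) × (ZMod p × ZMod p) => -q.1 + q.2.1 + q.2.2)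
      ↑(W ×ˢ X ×ˢ Y))
    (h₂ : Set.InjOn (fun q : (ZMod p × ZMod p) × (ZMod p × ZMod p) × (ZMod p × ZMod p) => q.1 - q.2.1 + q.2.2)
      ↑(W ×ˢ X ×ˢ Y))
    (h₃ : Set.InjOn (fun q : (ZMod p × ZMod p) × (ZMod p × ZMod p) × (ZMod p × ZMod p) => q.1 + q.2.1 - q.2.2)
      ↑(W ×ˢ X ×ˢ Y))
    (d₁₂ : Disjoint ((W ×ˢ X ×ˢ Y).image fun q => -q.1 + q.2.1 + q.2.2) ((W ×ˢ X ×ˢ Y).image fun q => q.1 - q.2.1 + q.2.2))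
    (d₁₃ : Disjoint ((W ×ˢ X ×ˢ Y).image fun q => -q.1 + q.2.1 + q.2.2) ((W ×ˢ X ×ˢ Y).image fun q => q.1 + q.2.1 - q.2.2))
    (d₂₃ : Disjoint ((W ×ˢ X ×ˢ Y).image fun q => q.1 - q.2.1 + q.2.2) ((W ×ˢ X ×ˢ Y).image fun q => q.1 + q.2.1 - q.2.2))
    (hcover : ((W ×ˢ X ×ˢ Y).image fun q => -q.1 + q.2.1 + q.2.2) ∪ ((W ×ˢ X ×ˢ Y).image fun q => q.1 - q.2.1 + q.2.2) ∪
      ((W ×ˢ X ×ˢ Y).image fun q => q.1 + q.2.1 - q.2.2) = univ.erase x₀) :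
    W.card ≠ 3 := by
  intro hW
  have hp : p.Prime := Fact.out
  obtain ⟨T, M, z₀, htile, hTM, h9⟩ := triangle_factor_of_part_three h₁ h₂ h₃ d₁₂ d₁₃ d₂₃ hcover hW
  by_cases hp3 : 3 ∣ p
  · -- p = 3: 9·#M + 1 = 9 is impossible
    have : p = 3 := ((Nat.prime_dvd_prime_iff_eq Nat.prime_three hp).1 hp3).symm
    subst this; omega
  · have hb := card_sub_card_bound hp3 T M z₀ htile
    rw [hTM, Nat.cast_mul, show ((2 : ℕ) : ℤ) * (M.card : ℤ) - M.card = M.card by ring,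
      abs_of_nonneg (by positivity)] at hb
    -- 9·#M + 1 = p², 3·#M ≤ 4p + 2 ⇒ p ≤ 12
    have hM : (9 * M.card + 1 : ℤ) = (p : ℤ) ^ 2 := by exact_mod_cast h9
    have hp12 : p ≤ 12 := by nlinarith
    have hp2 := hp.two_le
    interval_cases p <;> first | omega | exact absurd (hp.eq_one_or_self_of_dvd 2 (by norm_num)) (by omega)

/-- All three parts: a cube symmetric form over `ℤ_p × ℤ_p` has no part of size `3`. [folklore] -/
theorem cube_form_no_part_three {W X Y : Finset (ZMod p × ZMod p)} {x₀ : ZMod p × ZMod p}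
    (h₁ : Set.InjOn (fun q : (ZMod p × ZMod p) × (ZMod p × ZMod p) × (ZMod p × ZMod p) => -q.1 + q.2.1 + q.2.2)
      ↑(W ×ˢ X ×ˢ Y))
    (h₂ : Set.InjOn (fun q : (ZMod p × ZMod p) × (ZMod p × ZMod p) × (ZMod p × ZMod p) => q.1 - q.2.1 + q.2.2)
      ↑(W ×ˢ X ×ˢ Y))
    (h₃ : Set.InjOn (fun q : (ZMod p × ZMod p) × (ZMod p × ZMod p) × (ZMod p × ZMod p) => q.1 + q.2.1 - q.2.2)
      ↑(W ×ˢ X ×ˢ Y))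
    (d₁₂ : Disjoint ((W ×ˢ X ×ˢ Y).image fun q => -q.1 + q.2.1 + q.2.2) ((W ×ˢ X ×ˢ Y).image fun q => q.1 - q.2.1 + q.2.2))
    (d₁₃ : Disjoint ((W ×ˢ X ×ˢ Y).image fun q => -q.1 + q.2.1 + q.2.2) ((W ×ˢ X ×ˢ Y).image fun q => q.1 + q.2.1 - q.2.2))
    (d₂₃ : Disjoint ((W ×ˢ X ×ˢ Y).image fun q => q.1 - q.2.1 + q.2.2) ((W ×ˢ X ×ˢ Y).image fun q => q.1 + q.2.1 - q.2.2))
    (hcover : ((W ×ˢ X ×ˢ Y).image fun q => -q.1 + q.2.1 + q.2.2) ∪ ((W ×ˢ X ×ˢ Y).image fun q => q.1 - q.2.1 + q.2.2) ∪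
      ((W ×ˢ X ×ˢ Y).image fun q => q.1 + q.2.1 - q.2.2) = univ.erase x₀) :
    W.card ≠ 3 ∧ X.card ≠ 3 ∧ Y.card ≠ 3 := by
  obtain ⟨i₁, i₂, i₃, e₁₂, e₁₃, e₂₃, ecov⟩ := cube_symmetric_form_rotate h₁ h₂ h₃ d₁₂ d₁₃ d₂₃ hcover
  obtain ⟨j₁, j₂, j₃, f₁₂, f₁₃, f₂₃, fcov⟩ := cube_symmetric_form_rotate i₁ i₂ i₃ e₁₂ e₁₃ e₂₃ ecov
  exact ⟨cube_form_card_ne_three h₁ h₂ h₃ d₁₂ d₁₃ d₂₃ hcover, cube_form_card_ne_three i₁ i₂ i₃ e₁₂ e₁₃ e₂₃ ecov,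
    cube_form_card_ne_three j₁ j₂ j₃ f₁₂ f₁₃ f₂₃ fcov⟩

end Corollary

section Law

open Literature.Combinatorics.Additive

variable {p : ℕ} [Fact p.Prime] {G : Type} [Group G] [DecidableEq G]
  {ρ τ : ZMod p × ZMod p → G} {c₀ : ZMod p × ZMod p} {S T U : Finset G}

/-- In `ℤ_p × ℤ_p` with `p` odd every element is a double. [folklore] -/
theorem exists_add_self_eq (hp2 : p ≠ 2) (c : ZMod p × ZMod p) : ∃ a : ZMod p × ZMod p, a + a = c := by
  have h2 : (2 : ZMod p) ≠ 0 := by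
    intro h
    have := (ZMod.natCast_eq_zero_iff 2 p).1 (by exact_mod_cast h)
    exact hp2 ((Nat.prime_dvd_prime_iff_eq (Fact.out : p.Prime) Nat.prime_two).1 this)
  refine ⟨((2 : ZMod p)⁻¹ * c.1, (2 : ZMod p)⁻¹ * c.2), ?_⟩
  ext <;> simp only [Prod.fst_add, Prod.snd_add] <;> rw [← two_mul, ← mul_assoc, mul_inv_cancel₀ h2, one_mul]

/-- **No coset part of size three in a cube law triple over `Dih(ℤ_p²)` (kernel, all odd primes `p`).**  Let `G` be
dihedral-like over `ℤ_p × ℤ_p` (any presentation constant `c₀`).  If a TPP triple `(S, T, U)` of `G` has cube coset parts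
(`|S₀| = |S₁|`, `|T₀| = |T₁|`, `|U₀| = |U₁|`) and attains `3|S||T||U| + 8 = 8p²`, then no coset part has size `3`:
`|S₀| ≠ 3`, `|T₀| ≠ 3`, `|U₀| ≠ 3`. [folklore] -/
theorem cube_law_no_coset_part_three (hp2 : p ≠ 2)
    (hρρ : ∀ a b, ρ a * ρ b = ρ (a + b)) (hρτ : ∀ a b, ρ a * τ b = τ (b - a))
    (hτρ : ∀ a b, τ a * ρ b = τ (a + b)) (hττ : ∀ a b, τ a * τ b = ρ (c₀ + b - a))
    (hρ : Function.Injective ρ) (hτ : Function.Injective τ) (hne : ∀ a b, ρ a ≠ τ b)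
    (hsurj : ∀ g, (∃ a, ρ a = g) ∨ (∃ a, τ a = g))
    (h : TripleProductProperty S T U)
    (hS : (univ.filter fun a : ZMod p × ZMod p => ρ a ∈ S).card = (univ.filter fun a : ZMod p × ZMod p => τ a ∈ S).card)
    (hT : (univ.filter fun a : ZMod p × ZMod p => ρ a ∈ T).card = (univ.filter fun a : ZMod p × ZMod p => τ a ∈ T).card)
    (hU : (univ.filter fun a : ZMod p × ZMod p => ρ a ∈ U).card = (univ.filter fun a : ZMod p × ZMod p => τ a ∈ U).card)
    (hV : 3 * (S.card * T.card * U.card) + 8 = 8 * Fintype.card (ZMod p × ZMod p)) :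
    (univ.filter fun a : ZMod p × ZMod p => ρ a ∈ S).card ≠ 3 ∧
      (univ.filter fun a : ZMod p × ZMod p => ρ a ∈ T).card ≠ 3 ∧
      (univ.filter fun a : ZMod p × ZMod p => ρ a ∈ U).card ≠ 3 := by
  obtain ⟨W, X, Y, x₀, cW, cX, cY, i₁, i₂, i₃, e₁₂, e₁₃, e₂₃, ecov⟩ :=
    cube_symmetric_form_of_law hρρ hρτ hτρ hττ hρ hτ hne hsurj (exists_add_self_eq hp2) h hS hT hU hV
  obtain ⟨nW, nX, nY⟩ := cube_form_no_part_three i₁ i₂ i₃ e₁₂ e₁₃ e₂₃ ecov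
  exact ⟨cW ▸ nW, cX ▸ nX, cY ▸ nY⟩

end Law

end Summit.MatrixMultiplication.OmegaCensus
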